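import Summits.QuantumFields.YangMills.Theorems.FluctuationComparisonRegPrIntLS2BetaSectionsDescentConsistency
import Summits.QuantumFields.YangMills.Theorems.FluctuationComparisonRegPrIntLS2BetaBlockOffsetCoordinates
import HarnessLib

/-!
# S2β · D-GUARD ∕ (BG∞) — (L-Σ) PART 3∕5: THE FACE DATUM IS SLOWLY VARYING — one induction round of (STEP) (UV3-NODE §116 ADD.2)

Cell `ym3-torus` (YM ladder rung R3 = continuum `SU(2)` Yang–Mills on the three-torus at fixed lattice data — a RUNG: NOT d = 4, NOT infinite volume,
NOT a mass gap, NOT Clay).  Width seat «width 19» `ym3-torus-px19` (gen 25, ★p1 lineage), FREE px helper on crux `stmt-QuantumFields-20520`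
(`FluctuationComparisonRegPrIntL`; registry `Lines/semiclassical_s2beta.lean` UNTOUCHED, 0∕5); `--kind proof --supports stmt-QuantumFields-20520 --as helper`,
count-neutral, DEFINITION-FREE (0 `def`, 0 `instance`, 0 `notation`, 0 `sorry`, default heartbeats).  (BG∞) plan of record: UV3-NODE §116 + ADD.1 + ADD.2
(architect ruling px17 g23 2026-09-01T00:13:02Z; desk RULINGs №123 ∕ №127 (binder style) ∕ №132-A; LEAD RULINGs №66 ∕ №67).

WHY.  The stage-`s` filling of a block `Q` is fed the datum `Ψ_Q(x) := w_{D(Q,x)}(x)·g_{D(Q,x)}(x)·g_Q(x)⁻¹` on its odd faces.  Along a bond `b` with both ends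
on odd faces, both ends are moved by (CONS) to the single block `D* := update (D(Q,src)) b.dir (Q b.dir)`, which contains both ends and has STRICTLY smaller stage
(`st_dstar_lt`: an odd face axis other than `b.dir` drops; both ends on `b.dir`-faces is excluded by side `≥ 2`); then `Ψ_Q = w_{D*}·(g_{D*}·g_Q⁻¹)` at both ends
and ✓`dist1_mul_mul_inv_mul_le` splits the step into a lower-stage section step (`≤ B∕ρ`, induction hypothesis) and a transition step (`≤ η`, (TRANS)).

WHAT IS PROVED (sorry-free).  `ite_le_ite_of_imp`, `ite_lt_ite_of`, `tgt_apply_of_ne`, `mem_dstar_src`, `mem_dstar_tgt`, ★`st_dstar_lt`,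
★★★`face_datum_step : … → dist1 (Ψ_Q src · (Ψ_Q tgt)⁻¹) ≤ B ∕ ρ + η` (stage `st` pinned by the displayed indicator sum `hst`).

HONEST SCOPE.  Bookkeeping and group algebra over DISPLAYED hypotheses (the eight-colour table and the filling data are carried as functions PINNED by displayed
equations, in the style of ✓p839983's `hW`; nothing is defined).  The three FILLING LETTERS are HYPOTHESES of the final theorem (file (Σ-B5)); until they are
discharged ((L-I) ✓p839983, (L-T)∕(R3) px5, (L-S) px8, with the cone-centre lemmas (B3′)∕(B3-S)) `hSec`, hence `hBG`, (BG∞), `hsupp⁺` and D-GUARD's two `hsupp`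
letters are NOT proved.  Nothing of Bałaban's renormalisation-group analysis is asserted or proved ([Balaban1985RegularSpaces] Lemma 1 p.79 ∕ (1.29) p.81 is the
local, non-uniform statement in print; the N-uniform torus gluing is the (BG∞) plan's, NOT in print).  GAP♯∘ (`stub_uniformFibreGapOrbit`, registry UNTOUCHED), the
five registered stubs (0∕5), S2β, 20520, 19936, 19200, `YM3TorusSU2` are NOT proved; no registered stub is closed; rung R3 — NOT d = 4, NOT infinite volume, NOT a
mass gap, NOT Clay; the Yang–Mills mass gap is NOT proved.  Axioms standard.

References: T. Bałaban, CMP **99** (1985) 75–102 [Balaban1985RegularSpaces] (Lemma 1 p.79, (1.29) p.81).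
-/

set_option autoImplicit false

namespace Summit.QuantumFields.YangMills.Theorems.FluctuationComparisonRegPrIntLS2BetaSectionsFaceDatumStep

open Literature.MathematicalPhysics.QuantumFieldTheory.Balaban1983to89
open T4CubeChartGnomonic (SU2)
open Summit.QuantumFields.YangMills.Theorems.FluctuationComparisonRegPrIntLS2BetaDescendedBlock
open Summit.QuantumFields.YangMills.Theorems.FluctuationComparisonRegPrIntLS2BetaSectionsColourTable
open Summit.QuantumFields.YangMills.Theorems.FluctuationComparisonRegPrIntLS2BetaSectionsDescentConsistency
open Summit.QuantumFields.YangMills.Theorems.FluctuationComparisonRegPrIntLS2BetaBlockOffsetCoordinates (offset_tgt_dir)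

section Blocks
variable {P : Params} {M : ℕ} (len start : Fin M → ℕ)
  (hlen1 : ∀ i, 1 ≤ len i)
  (hz : ∀ i : Fin M, (i : ℕ) = 0 → start i = 0)
  (hs : ∀ i j : Fin M, (j : ℕ) = (i : ℕ) + 1 → start j = start i + len i)
  (hl : ∀ i : Fin M, (i : ℕ) + 1 = M → start i + len i = P.sitesPerDir 0) (hM : 3 ≤ M) (hEven : Even M)
  (D : Fin M → ZMod (P.sitesPerDir 0) → Fin M)
  (hD : ∀ (i : Fin M) (v : ZMod (P.sitesPerDir 0)),
      ((i : ℕ) % 2 = 1 ∧ (v - ((start i : ℕ) : ZMod (P.sitesPerDir 0))).val = 0 ∧ ((i : ℕ) = (D i v : ℕ) + 1 ∨ ((D i v : ℕ) + 1 = M ∧ (i : ℕ) = 0))) ∨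
      ((i : ℕ) % 2 = 1 ∧ (v - ((start i : ℕ) : ZMod (P.sitesPerDir 0))).val = len i ∧ ((D i v : ℕ) = (i : ℕ) + 1 ∨ ((i : ℕ) + 1 = M ∧ (D i v : ℕ) = 0))) ∨
      (¬ ((i : ℕ) % 2 = 1 ∧ ((v - ((start i : ℕ) : ZMod (P.sitesPerDir 0))).val = 0 ∨ (v - ((start i : ℕ) : ZMod (P.sitesPerDir 0))).val = len i)) ∧
        D i v = i))
  (κ0 κ1 κ2 : Fin P.d) (htri : ∀ κ : Fin P.d, κ = κ0 ∨ κ = κ1 ∨ κ = κ2)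
  (g : (Fin P.d → Fin M) → Site P 0 → SU2)
  (W₁ : (Fin P.d → Fin M) → Fin P.d → Site P 0 → SU2)
  (W₂ : (Fin P.d → Fin M) → Fin P.d → Fin P.d → Site P 0 → SU2)
  (W₃ : (Fin P.d → Fin M) → Site P 0 → SU2)
  (wle1 wle2 w : (Fin P.d → Fin M) → Site P 0 → SU2)
  (hwle1 : ∀ R x, wle1 R x =
    if ((R κ0 : Fin M) : ℕ) % 2 = 1 then (if ((R κ1 : Fin M) : ℕ) % 2 = 1 then 1 else if ((R κ2 : Fin M) : ℕ) % 2 = 1 then 1 else W₁ R κ0 x)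
    else (if ((R κ1 : Fin M) : ℕ) % 2 = 1 then (if ((R κ2 : Fin M) : ℕ) % 2 = 1 then 1 else W₁ R κ1 x)
      else (if ((R κ2 : Fin M) : ℕ) % 2 = 1 then W₁ R κ2 x else 1)))
  (hwle2 : ∀ R x, wle2 R x =
    if ((R κ0 : Fin M) : ℕ) % 2 = 1 then (if ((R κ1 : Fin M) : ℕ) % 2 = 1 then (if ((R κ2 : Fin M) : ℕ) % 2 = 1 then 1 else W₂ R κ0 κ1 x)
      else (if ((R κ2 : Fin M) : ℕ) % 2 = 1 then W₂ R κ0 κ2 x else W₁ R κ0 x))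
    else (if ((R κ1 : Fin M) : ℕ) % 2 = 1 then (if ((R κ2 : Fin M) : ℕ) % 2 = 1 then W₂ R κ1 κ2 x else W₁ R κ1 x)
      else (if ((R κ2 : Fin M) : ℕ) % 2 = 1 then W₁ R κ2 x else 1)))
  (hw : ∀ R x, w R x =
    if ((R κ0 : Fin M) : ℕ) % 2 = 1 then (if ((R κ1 : Fin M) : ℕ) % 2 = 1 then (if ((R κ2 : Fin M) : ℕ) % 2 = 1 then W₃ R x else W₂ R κ0 κ1 x)
      else (if ((R κ2 : Fin M) : ℕ) % 2 = 1 then W₂ R κ0 κ2 x else W₁ R κ0 x))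
    else (if ((R κ1 : Fin M) : ℕ) % 2 = 1 then (if ((R κ2 : Fin M) : ℕ) % 2 = 1 then W₂ R κ1 κ2 x else W₁ R κ1 x)
      else (if ((R κ2 : Fin M) : ℕ) % 2 = 1 then W₁ R κ2 x else 1)))
  (hA1 : ∀ (Q : Fin P.d → Fin M) (α : Fin P.d) (x : Site P 0),
      (∀ κ, (x κ - ((start (Q κ) : ℕ) : ZMod (P.sitesPerDir 0))).val ≤ len (Q κ)) →
      ((x α - ((start (Q α) : ℕ) : ZMod (P.sitesPerDir 0))).val = 0 ∨ (x α - ((start (Q α) : ℕ) : ZMod (P.sitesPerDir 0))).val = len (Q α)) →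
      W₁ Q α x = g (fun κ => D (Q κ) (x κ)) x * (g Q x)⁻¹)
  (hA2 : ∀ (Q : Fin P.d → Fin M) (α β : Fin P.d) (x : Site P 0),
      (∀ κ, (x κ - ((start (Q κ) : ℕ) : ZMod (P.sitesPerDir 0))).val ≤ len (Q κ)) →
      (((x α - ((start (Q α) : ℕ) : ZMod (P.sitesPerDir 0))).val = 0 ∨ (x α - ((start (Q α) : ℕ) : ZMod (P.sitesPerDir 0))).val = len (Q α)) ∨
        ((x β - ((start (Q β) : ℕ) : ZMod (P.sitesPerDir 0))).val = 0 ∨ (x β - ((start (Q β) : ℕ) : ZMod (P.sitesPerDir 0))).val = len (Q β))) →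
      W₂ Q α β x = wle1 (fun κ => D (Q κ) (x κ)) x * g (fun κ => D (Q κ) (x κ)) x * (g Q x)⁻¹)
  (hA3 : ∀ (Q : Fin P.d → Fin M) (x : Site P 0),
      (∀ κ, (x κ - ((start (Q κ) : ℕ) : ZMod (P.sitesPerDir 0))).val ≤ len (Q κ)) →
      (∃ κ, (x κ - ((start (Q κ) : ℕ) : ZMod (P.sitesPerDir 0))).val = 0 ∨ (x κ - ((start (Q κ) : ℕ) : ZMod (P.sitesPerDir 0))).val = len (Q κ)) →
      W₃ Q x = wle2 (fun κ => D (Q κ) (x κ)) x * g (fun κ => D (Q κ) (x κ)) x * (g Q x)⁻¹)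
variable (st : (Fin P.d → Fin M) → ℕ)
  (hst : ∀ R, st R = (if ((R κ0 : Fin M) : ℕ) % 2 = 1 then 1 else 0) + (if ((R κ1 : Fin M) : ℕ) % 2 = 1 then 1 else 0) +
    (if ((R κ2 : Fin M) : ℕ) % 2 = 1 then 1 else 0))

/-! ## §4 The face datum of a block is slowly varying (one induction round) -/

/-- Monotonicity of an indicator. [folklore] -/
theorem ite_le_ite_of_imp {p q : Prop} [Decidable p] [Decidable q] (h : p → q) :
    (if p then (1 : ℕ) else 0) ≤ (if q then 1 else 0) := by
  by_cases hp : p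
  · rw [if_pos hp, if_pos (h hp)]
  · rw [if_neg hp]; exact Nat.zero_le _

/-- Strict monotonicity of an indicator. [folklore] -/
theorem ite_lt_ite_of {p q : Prop} [Decidable p] [Decidable q] (hp : ¬ p) (hq : q) :
    (if p then (1 : ℕ) else 0) < (if q then 1 else 0) := by
  rw [if_neg hp, if_pos hq]; exact Nat.zero_lt_one

/-- Off the bond's direction the target has the source's coordinate. [folklore] -/
theorem tgt_apply_of_ne (b : PBond P 0) {κ : Fin P.d} (hκ : κ ≠ b.dir) : b.tgt κ = b.src κ := by
  show Function.update b.src b.dir (b.src b.dir + 1) κ = b.src κ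
  exact Function.update_of_ne hκ _ _


include hlen1 hz hs hl hD in
/-- The block `D* := D(Q, src)` with its `b.dir`-entry reset to `Q`'s contains the source … [folklore] -/
theorem mem_dstar_src (Q : Fin P.d → Fin M) (b : PBond P 0)
    (hbs : ∀ κ, (b.src κ - ((start (Q κ) : ℕ) : ZMod (P.sitesPerDir 0))).val ≤ len (Q κ)) :
    ∀ κ, (b.src κ - ((start (Function.update (fun κ => D (Q κ) (b.src κ)) b.dir (Q b.dir) κ) : ℕ) : ZMod (P.sitesPerDir 0))).val ≤
      len (Function.update (fun κ => D (Q κ) (b.src κ)) b.dir (Q b.dir) κ) := by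
  intro κ
  by_cases hκ : κ = b.dir
  · subst hκ; rw [Function.update_self]; exact hbs _
  · rw [Function.update_of_ne hκ]
    exact dblock_mem len start hlen1 hz hs hl D hD Q b.src hbs κ

include hlen1 hz hs hl hD in
/-- … and the target of the bond. [folklore] -/
theorem mem_dstar_tgt (Q : Fin P.d → Fin M) (b : PBond P 0)
    (hbs : ∀ κ, (b.src κ - ((start (Q κ) : ℕ) : ZMod (P.sitesPerDir 0))).val ≤ len (Q κ))
    (hbt : ∀ κ, (b.tgt κ - ((start (Q κ) : ℕ) : ZMod (P.sitesPerDir 0))).val ≤ len (Q κ)) :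
    ∀ κ, (b.tgt κ - ((start (Function.update (fun κ => D (Q κ) (b.src κ)) b.dir (Q b.dir) κ) : ℕ) : ZMod (P.sitesPerDir 0))).val ≤
      len (Function.update (fun κ => D (Q κ) (b.src κ)) b.dir (Q b.dir) κ) := by
  intro κ
  by_cases hκ : κ = b.dir
  · subst hκ; rw [Function.update_self]; exact hbt _
  · rw [Function.update_of_ne hκ, tgt_apply_of_ne b hκ]
    exact dblock_mem len start hlen1 hz hs hl D hD Q b.src hbs κ

include hEven hD htri hst in
/-- ★ **THE STAGE DROPS AT `D*`** when both ends of the bond lie on odd faces of `Q` (blocks of side `≥ 2`, no wrap). [folklore] -/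
theorem st_dstar_lt (hlen2 : ∀ i, 2 ≤ len i) (hN : ∀ i, len i + 1 < P.sitesPerDir 0) (Q : Fin P.d → Fin M) (b : PBond P 0)
    (hbs : ∀ κ, (b.src κ - ((start (Q κ) : ℕ) : ZMod (P.sitesPerDir 0))).val ≤ len (Q κ))
    (hFs : ∃ κ, ((Q κ : Fin M) : ℕ) % 2 = 1 ∧ ((b.src κ - ((start (Q κ) : ℕ) : ZMod (P.sitesPerDir 0))).val = 0 ∨
      (b.src κ - ((start (Q κ) : ℕ) : ZMod (P.sitesPerDir 0))).val = len (Q κ)))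
    (hFt : ∃ κ, ((Q κ : Fin M) : ℕ) % 2 = 1 ∧ ((b.tgt κ - ((start (Q κ) : ℕ) : ZMod (P.sitesPerDir 0))).val = 0 ∨
      (b.tgt κ - ((start (Q κ) : ℕ) : ZMod (P.sitesPerDir 0))).val = len (Q κ))) :
    st (Function.update (fun κ => D (Q κ) (b.src κ)) b.dir (Q b.dir)) < st Q := by
  -- every flag of `D*` is below `Q`'s
  have hle : ∀ κ, ((Function.update (fun κ => D (Q κ) (b.src κ)) b.dir (Q b.dir) κ : Fin M) : ℕ) % 2 = 1 → ((Q κ : Fin M) : ℕ) % 2 = 1 := by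
    intro κ h
    by_cases hκ : κ = b.dir
    · subst hκ; rwa [Function.update_self] at h
    · rw [Function.update_of_ne hκ] at h
      exact dblock_odd_imp len start hEven D hD Q b.src κ h
  -- one flag drops: an odd face axis different from the bond's direction
  have hdrop : ∃ κ, ((Q κ : Fin M) : ℕ) % 2 = 1 ∧ ¬ ((Function.update (fun κ => D (Q κ) (b.src κ)) b.dir (Q b.dir) κ : Fin M) : ℕ) % 2 = 1 := by
    obtain ⟨κ₁, ho₁, hf₁⟩ := hFs
    by_cases h₁ : κ₁ = b.dir
    · obtain ⟨κ₂, ho₂, hf₂⟩ := hFt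
      by_cases h₂ : κ₂ = b.dir
      · -- both ends on `b.dir`-faces: impossible for a side `≥ 2`
        exfalso
        subst h₁; subst h₂
        have ht := offset_tgt_dir (fun κ => start (Q κ)) b rfl (lt_of_le_of_lt (Nat.add_le_add_right (hbs b.dir) 1) (hN _))
        have h2 := hlen2 (Q b.dir)
        rcases hf₁ with h0 | hL <;> rcases hf₂ with h0' | hL' <;> omega
      · refine ⟨κ₂, ho₂, ?_⟩
        rw [Function.update_of_ne h₂]
        rw [tgt_apply_of_ne b h₂] at hf₂
        exact dflag_even_of_face len start hEven D hD Q b.src κ₂ ho₂ hf₂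
    · refine ⟨κ₁, ho₁, ?_⟩
      rw [Function.update_of_ne h₁]
      exact dflag_even_of_face len start hEven D hD Q b.src κ₁ ho₁ hf₁
  obtain ⟨κ, hoκ, hnκ⟩ := hdrop
  rw [hst, hst]
  have m0 := ite_le_ite_of_imp (hle κ0)
  have m1 := ite_le_ite_of_imp (hle κ1)
  have m2 := ite_le_ite_of_imp (hle κ2)
  rcases htri κ with hκe | hκe | hκe <;> rw [hκe] at hoκ hnκ
  · have := ite_lt_ite_of hnκ hoκ; omega
  · have := ite_lt_ite_of hnκ hoκ; omega
  · have := ite_lt_ite_of hnκ hoκ; omega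

include hlen1 hz hs hl hM hEven hD htri hwle1 hwle2 hw hA1 hA2 hA3 hst in
/-- ★★★ **THE FACE DATUM IS SLOWLY VARYING** (one induction round of (STEP)): if every block of smaller stage than `Q` has a `(B∕ρ)`-Lipschitz section and the
transitions are `η`-slow, then along a bond with both ends on odd faces of `Q` the face datum `Ψ_Q := w_{D(Q,·)}·g_{D(Q,·)}·g_Q⁻¹` moves by `≤ B∕ρ + η`. [folklore] -/
theorem face_datum_step (hlen2 : ∀ i, 2 ≤ len i) (hN : ∀ i, len i + 1 < P.sitesPerDir 0) {B η : ℝ} {ρ : ℕ}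
    (hTrans : ∀ (Q Q' : Fin P.d → Fin M) (b : PBond P 0),
      (∀ κ, (b.src κ - ((start (Q κ) : ℕ) : ZMod (P.sitesPerDir 0))).val ≤ len (Q κ)) →
      (∀ κ, (b.tgt κ - ((start (Q κ) : ℕ) : ZMod (P.sitesPerDir 0))).val ≤ len (Q κ)) →
      (∀ κ, (b.src κ - ((start (Q' κ) : ℕ) : ZMod (P.sitesPerDir 0))).val ≤ len (Q' κ)) →
      (∀ κ, (b.tgt κ - ((start (Q' κ) : ℕ) : ZMod (P.sitesPerDir 0))).val ≤ len (Q' κ)) →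
      dist1 ((g Q b.src * (g Q' b.src)⁻¹)⁻¹ * (g Q b.tgt * (g Q' b.tgt)⁻¹)) ≤ η)
    (Q : Fin P.d → Fin M)
    (IH : ∀ R : Fin P.d → Fin M, st R < st Q → ∀ b : PBond P 0,
      (∀ κ, (b.src κ - ((start (R κ) : ℕ) : ZMod (P.sitesPerDir 0))).val ≤ len (R κ)) →
      (∀ κ, (b.tgt κ - ((start (R κ) : ℕ) : ZMod (P.sitesPerDir 0))).val ≤ len (R κ)) →
      dist1 (w R b.src * (w R b.tgt)⁻¹) ≤ B / ρ)
    (b : PBond P 0)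
    (hbs : ∀ κ, (b.src κ - ((start (Q κ) : ℕ) : ZMod (P.sitesPerDir 0))).val ≤ len (Q κ))
    (hbt : ∀ κ, (b.tgt κ - ((start (Q κ) : ℕ) : ZMod (P.sitesPerDir 0))).val ≤ len (Q κ))
    (hFs : ∃ κ, ((Q κ : Fin M) : ℕ) % 2 = 1 ∧ ((b.src κ - ((start (Q κ) : ℕ) : ZMod (P.sitesPerDir 0))).val = 0 ∨
      (b.src κ - ((start (Q κ) : ℕ) : ZMod (P.sitesPerDir 0))).val = len (Q κ)))
    (hFt : ∃ κ, ((Q κ : Fin M) : ℕ) % 2 = 1 ∧ ((b.tgt κ - ((start (Q κ) : ℕ) : ZMod (P.sitesPerDir 0))).val = 0 ∨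
      (b.tgt κ - ((start (Q κ) : ℕ) : ZMod (P.sitesPerDir 0))).val = len (Q κ))) :
    dist1 ((w (fun κ => D (Q κ) (b.src κ)) b.src * g (fun κ => D (Q κ) (b.src κ)) b.src * (g Q b.src)⁻¹) *
      (w (fun κ => D (Q κ) (b.tgt κ)) b.tgt * g (fun κ => D (Q κ) (b.tgt κ)) b.tgt * (g Q b.tgt)⁻¹)⁻¹) ≤ B / ρ + η := by
  have hms := mem_dstar_src len start hlen1 hz hs hl D hD Q b hbs
  have hmt := mem_dstar_tgt len start hlen1 hz hs hl D hD Q b hbs hbt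
  have hlt := st_dstar_lt len start hEven D hD κ0 κ1 κ2 htri st hst hlen2 hN Q b hbs hFs hFt
  -- consistency moves both ends to the block `D*`
  have hcs := cons len start hlen1 hz hs hl hM hEven D hD κ0 κ1 κ2 htri g W₁ W₂ W₃ wle1 wle2 w hwle1 hwle2 hw hA1 hA2 hA3
    (fun κ => D (Q κ) (b.src κ)) (Function.update (fun κ => D (Q κ) (b.src κ)) b.dir (Q b.dir)) b.src
    (dblock_mem len start hlen1 hz hs hl D hD Q b.src hbs) hms
  have hct := cons len start hlen1 hz hs hl hM hEven D hD κ0 κ1 κ2 htri g W₁ W₂ W₃ wle1 wle2 w hwle1 hwle2 hw hA1 hA2 hA3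
    (fun κ => D (Q κ) (b.tgt κ)) (Function.update (fun κ => D (Q κ) (b.src κ)) b.dir (Q b.dir)) b.tgt
    (dblock_mem len start hlen1 hz hs hl D hD Q b.tgt hbt) hmt
  have hEq : (w (fun κ => D (Q κ) (b.src κ)) b.src * g (fun κ => D (Q κ) (b.src κ)) b.src * (g Q b.src)⁻¹) *
      (w (fun κ => D (Q κ) (b.tgt κ)) b.tgt * g (fun κ => D (Q κ) (b.tgt κ)) b.tgt * (g Q b.tgt)⁻¹)⁻¹ =
      (w (Function.update (fun κ => D (Q κ) (b.src κ)) b.dir (Q b.dir)) b.src *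
        (g (Function.update (fun κ => D (Q κ) (b.src κ)) b.dir (Q b.dir)) b.src * (g Q b.src)⁻¹)) *
      (w (Function.update (fun κ => D (Q κ) (b.src κ)) b.dir (Q b.dir)) b.tgt *
        (g (Function.update (fun κ => D (Q κ) (b.src κ)) b.dir (Q b.dir)) b.tgt * (g Q b.tgt)⁻¹))⁻¹ := by
    rw [hcs, hct]; simp only [mul_assoc]
  rw [hEq]
  have h1 := dist1_mul_mul_inv_mul_le (w (Function.update (fun κ => D (Q κ) (b.src κ)) b.dir (Q b.dir)) b.src)
    (g (Function.update (fun κ => D (Q κ) (b.src κ)) b.dir (Q b.dir)) b.src * (g Q b.src)⁻¹)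
    (w (Function.update (fun κ => D (Q κ) (b.src κ)) b.dir (Q b.dir)) b.tgt)
    (g (Function.update (fun κ => D (Q κ) (b.src κ)) b.dir (Q b.dir)) b.tgt * (g Q b.tgt)⁻¹)
  have h2 := IH _ hlt b hms hmt
  have h3 := hTrans (Function.update (fun κ => D (Q κ) (b.src κ)) b.dir (Q b.dir)) Q b hms hmt hbs hbt
  linarith

end Blocks

end Summit.QuantumFields.YangMills.Theorems.FluctuationComparisonRegPrIntLS2BetaSectionsFaceDatumStep
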